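import Mathlib.Algebra.BigOperators.Ring.Finset
import Mathlib.Data.Real.Basic
import Mathlib.Data.Fintype.Basic
import Mathlib.Algebra.Module.Pi
import Mathlib.Tactic.FieldSimp
import Mathlib.Tactic.Ring
import Mathlib.Algebra.BigOperators.Fin
import Mathlib.Data.Fin.Tuple.Basic
import Mathlib.Data.Fintype.BigOperators
import HarnessLib

/-!
# Annealed importance sampling: the weight is unbiased for the ratio of normalising constants
# (Neal 2001, §2) — PROVED on a finite state space, for any number of annealing steps

Topic `Probability/ImportanceSampling`; namespace `Literature.Probability.ImportanceSampling.AIS`.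
Everything is PROVED (finite sums); no named fact, no axiom. Companion of `BridgeSampling.lean`
(ratios of normalising constants on a finite space) and `LogNormalWeights.lean` (the dispersion law
of such weights when their logarithm is Gaussian).

Source, VERBATIM [cite: Neal2001AIS, §2] (R. M. Neal, *Annealed importance sampling*, Statistics
and Computing 11 (2001) 125–139 = arXiv:physics/9803008, §2 "The annealed importance sampling
procedure"; held text `paper:arxiv-physics_9803008` p0004:L3–L13, L34–L45, L50–L57, p0005:L15–L24):
"Suppose that we wish to find the expectation of some function of `x` with respect to a
distribution … `p_0(x)`. We have available a sequence of other distributions, given by `p_1(x)` up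
to `p_n(x)`, … which satisfy `p_j(x) ≠ 0` wherever `p_{j-1}(x) ≠ 0`. For each distribution, we must
be able to compute some function `f_j(x)` that is proportional to `p_j(x)`. We must also have some
method for sampling from `p_n` … Finally, for each `j` … we must be able to simulate some Markov
chain transition, `T_j`, that leaves `p_j` invariant. … For the annealed importance sampling scheme
to be valid, each `T_j` must leave the corresponding `p_j` invariant, but it is not essential that
each `T_j` produce an ergodic Markov chain … To generate each point … we first generate a sequence
of points, `x_{n-1}, …, x_0` [generate `x_{n-1}` from `p_n`; generate `x_{n-2}` from `x_{n-1}` using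
`T_{n-1}`; …; generate `x_0` from `x_1` using `T_1`] … and set
`w^{(i)} = (f_{n-1}(x_{n-1})/f_n(x_{n-1})) (f_{n-2}(x_{n-2})/f_{n-1}(x_{n-2})) ⋯ (f_0(x_0)/f_1(x_0))`.
… Annealed importance sampling also provides an estimate of the ratio of the normalizing constants
for `f_0` and `f_n`. … The average of the importance weights, `Σ w^{(i)}/N`, converges to the ratio
of these normalizing constants, `Z_0/Z_n`, where `Z_0 = ∫ f_0(x) dx` and `Z_n = ∫ f_n(x) dx`."

WHAT IS TYPED (our indexing runs FORWARD: the chain STARTS at the law `f 0/Z₀` that can be sampled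
and the `k`-th step re-weights by `f k (x)/f (k-1) (x)` at the CURRENT point and then moves with a
kernel `T k` that leaves `f k` invariant — Neal's scheme read from `p_n` towards `p_0`; his extra
final re-weighting without a move is the case `T = id`, which is invariant for anything):
* `Invariant T f` — `Σ_x f(x) T(x, y) = f(y)` for all `y` (the kernel leaves the unnormalised
  target invariant); `mass f = Σ_x f(x)` (the normalising constant `Z`);
* `step f f' T g` — one annealing step acting on the WEIGHTED OCCUPATION `g`
  (`g(x) = E[w ; X = x]` summed over all paths arriving at `x`): `y ↦ Σ_x g(x) (f'(x)/f(x)) T(x, y)`;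
  `occupation f₀ g steps` — the recursion over a list of steps `(f', T)` (Chapman–Kolmogorov);
* **`step_smul`** — if `T` leaves `f'` invariant and `f' ≪ f` (Neal's "`p_j ≠ 0` wherever
  `p_{j-1} ≠ 0`"), a `g` proportional to `f` is mapped to the SAME multiple of `f'`;
* **`occupation_smul`** — by induction, after any list of such steps the weighted occupation is
  `c • f_last`; hence **`mass_occupation`**: started from the probability vector `f₀/Z₀`, the total
  expected weight is `Z_last/Z₀` — Neal's "the average of the importance weights converges to the
  ratio of normalizing constants" in its exact finite-`N` form `E[w] = Z_K/Z_0` — and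
  **`sum_occupation_mul`**: `E[w · a(X_K)] = (1/Z₀) Σ_x f_K(x) a(x)`, i.e. the weighted average
  estimates `E_{p_K}[a]` (Neal's eq. for expectations).
Only the algebraic invariance `Σ_x f'(x)T(x,y) = f'(y)` is used: neither positivity nor
row-normalisation of `T` enters the identity (they are what makes `T` simulable, not what makes the
weight unbiased) — stated as printed otherwise. Not here: variances (§4 of the paper), the
continuous-state version, Markov-chain sampling of the start law (§2, last paragraph).
(Filed by the pub-qed tropical-track engine seat E3, whose AIS arm class rests on exactly this
identity; VALUE-FREE.)

ALSO TYPED BELOW (section `PathLaw`, top-level names in `Literature.Probability.ImportanceSampling`;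
pub-qed literature seat g35, first landed as p377840 and re-landed after the whole-file collision with
p377848): the explicit PATH-LAW form over `Fin (m+1) → Ω` — `sum_pathLaw`,
`sum_pathLaw_mul_aisWeight_mul`, `aisWeight_mean_eq`, `aisWeightedMean_eq` (see the section
docstring). independent recomputation; certified where stated, statistical where stated; no
new-physics claim.
-/

noncomputable section

namespace Literature.Probability.ImportanceSampling

namespace AIS

open Finset

variable {S : Type*} [Fintype S]

/-- The normalising constant `Z = Σ_x f(x)` of an unnormalised target on a finite space.
[cite: Neal2001AIS, §2] -/
def mass (f : S → ℝ) : ℝ := ∑ x, f x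

/-- `T` leaves the (unnormalised) target `f` invariant: `Σ_x f(x) T(x, y) = f(y)` for every `y`
("each `T_j` must leave the corresponding `p_j` invariant"). [cite: Neal2001AIS, §2] -/
def Invariant (T : S → S → ℝ) (f : S → ℝ) : Prop := ∀ y, ∑ x, f x * T x y = f y

/-- One annealing step on the weighted occupation `g` (`g(x)` = expected accumulated weight of the
paths currently at `x`): re-weight by `f'(x)/f(x)` at the current point, then move with `T`.
[cite: Neal2001AIS, §2] -/
def step (f f' : S → ℝ) (T : S → S → ℝ) (g : S → ℝ) : S → ℝ :=
  fun y ↦ ∑ x, g x * (f' x / f x) * T x y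

/-- The weighted occupation after a list of annealing steps `(f₁, T₁), (f₂, T₂), …` started from the
occupation `g` under the current target `f` (Chapman–Kolmogorov recursion).
[cite: Neal2001AIS, §2] -/
def occupation : (S → ℝ) → (S → ℝ) → List ((S → ℝ) × (S → S → ℝ)) → (S → ℝ)
  | _, g, [] => g
  | f, g, (p :: rest) => occupation p.1 (step f p.1 p.2 g) rest

/-- The last target of a list of steps (the start target if the list is empty).
[cite: Neal2001AIS, §2] -/
def lastTarget : (S → ℝ) → List ((S → ℝ) × (S → S → ℝ)) → (S → ℝ)
  | f, [] => f
  | _, (p :: rest) => lastTarget p.1 rest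

/-- Neal's chain of conditions along a list of steps: every kernel leaves its target invariant and
every target is dominated by the previous one (`f'(x) ≠ 0 → f(x) ≠ 0`). [cite: Neal2001AIS, §2] -/
def Admissible : (S → ℝ) → List ((S → ℝ) × (S → S → ℝ)) → Prop
  | _, [] => True
  | f, (p :: rest) => Invariant p.2 p.1 ∧ (∀ x, p.1 x ≠ 0 → f x ≠ 0) ∧ Admissible p.1 rest

/-- The identity (unit) kernel leaves every target invariant — Neal's final re-weighting without a
move is the step `(f_K, 1)`. [cite: Neal2001AIS, §2] -/
theorem invariant_one [DecidableEq S] (f : S → ℝ) :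
    Invariant (fun x y ↦ if x = y then (1 : ℝ) else 0) f := by
  intro y
  simp [Finset.sum_ite_eq', Finset.mem_univ]

/-- ONE STEP: if `T` leaves `f'` invariant and `f' ≪ f`, an occupation proportional to `f` is carried
to the same multiple of `f'`: `step f f' T (c • f) = c • f'`. [cite: Neal2001AIS, §2] -/
theorem step_smul {f f' : S → ℝ} {T : S → S → ℝ} (hT : Invariant T f')
    (hdom : ∀ x, f' x ≠ 0 → f x ≠ 0) (c : ℝ) : step f f' T (c • f) = c • f' := by
  funext y
  have hpt : ∀ x, f x * (f' x / f x) = f' x := by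
    intro x
    by_cases hx : f x = 0
    · have : f' x = 0 := by
        by_contra h
        exact hdom x h hx
      simp [hx, this]
    · field_simp
  simp only [step, Pi.smul_apply, smul_eq_mul]
  calc ∑ x, c * f x * (f' x / f x) * T x y = c * ∑ x, f' x * T x y := by
        rw [Finset.mul_sum]
        refine Finset.sum_congr rfl fun x _ ↦ ?_
        rw [show c * f x * (f' x / f x) * T x y = c * ((f x * (f' x / f x)) * T x y) by ring, hpt x]
    _ = c * f' y := by rw [hT y]

/-- ANY NUMBER OF STEPS: along an admissible list the weighted occupation stays proportional to the
current target with the SAME constant: `occupation f (c • f) steps = c • lastTarget f steps`.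
[cite: Neal2001AIS, §2] -/
theorem occupation_smul :
    ∀ (steps : List ((S → ℝ) × (S → S → ℝ))) (f : S → ℝ) (c : ℝ),
      Admissible f steps → occupation f (c • f) steps = c • lastTarget f steps
  | [], f, c, _ => rfl
  | (p :: rest), f, c, h => by
    obtain ⟨hT, hdom, hrest⟩ := h
    show occupation p.1 (step f p.1 p.2 (c • f)) rest = c • lastTarget p.1 rest
    rw [step_smul hT hdom c]
    exact occupation_smul rest p.1 c hrest

/-- **AIS IS UNBIASED FOR THE RATIO OF NORMALISING CONSTANTS** (finite state space, exact form of
"the average of the importance weights converges to `Z_0/Z_n`"): started from the PROBABILITY vector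
`f₀/Z₀`, the total expected weight after an admissible list of steps is `Z_last/Z₀` (meaningful for
`Z₀ ≠ 0`; with the field convention `0⁻¹ = 0` both sides vanish when `Z₀ = 0`). [cite: Neal2001AIS, §2] -/
theorem mass_occupation (f₀ : S → ℝ) (steps : List ((S → ℝ) × (S → S → ℝ)))
    (h : Admissible f₀ steps) :
    mass (occupation f₀ ((mass f₀)⁻¹ • f₀) steps) = mass (lastTarget f₀ steps) / mass f₀ := by
  rw [occupation_smul steps f₀ _ h]
  simp only [mass, Pi.smul_apply, smul_eq_mul]
  rw [← Finset.mul_sum, div_eq_inv_mul]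

/-- Expectations: `E[w · a(X_K)] = (1/Z₀) Σ_x f_K(x) a(x) = (Z_K/Z₀) · E_{p_K}[a]` — the weighted
average of `a` over the final states estimates the expectation of `a` under the final target.
[cite: Neal2001AIS, §2] -/
theorem sum_occupation_mul (f₀ : S → ℝ) (steps : List ((S → ℝ) × (S → S → ℝ)))
    (h : Admissible f₀ steps) (a : S → ℝ) :
    ∑ x, occupation f₀ ((mass f₀)⁻¹ • f₀) steps x * a x
      = (mass f₀)⁻¹ * ∑ x, lastTarget f₀ steps x * a x := by
  rw [occupation_smul steps f₀ _ h]
  simp only [Pi.smul_apply, smul_eq_mul, Finset.mul_sum, mul_assoc]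

/-- The two-step case written as an explicit PATH SUM, to make the recursion's meaning plain:
`Σ_{x₀,x₁,y} p₀(x₀) (f₁/f₀)(x₀) T₁(x₀,x₁) (f₂/f₁)(x₁) T₂(x₁,y)` is what `occupation` computes
(summed over the final state `y`). [cite: Neal2001AIS, §2] -/
theorem mass_occupation_two_eq_pathSum (f₀ f₁ f₂ : S → ℝ) (T₁ T₂ : S → S → ℝ) (p₀ : S → ℝ) :
    mass (occupation f₀ p₀ [(f₁, T₁), (f₂, T₂)])
      = ∑ y, ∑ x₁, ∑ x₀, p₀ x₀ * (f₁ x₀ / f₀ x₀) * T₁ x₀ x₁ * (f₂ x₁ / f₁ x₁) * T₂ x₁ y := by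
  simp only [mass, occupation, step, Finset.sum_mul]

end AIS

/-! ## The explicit PATH-LAW form of the same §2 (lit g35; first landed as `p377840`, re-landed here
after the whole-file collision with `p377848` recorded on the lane INBOX l.22217)

Time-ordered paths `y : Fin (m+1) → Ω` (`m` transitions, `m + 1` points); `f t` = the `t`-th
unnormalised density in TIME order (`f 0` = start law = the source's `f_n`, `f (m+1)` = target = the
source's `f_0`), `T t x z` = the transition used at time `t` (`1 ≤ t ≤ m`, leaving `f t` invariant).
The (unnormalised) LAW of a path, `f 0 (y 0) · Π_{t<m} T (t+1) (y t) (y (t+1))`, and its AIS WEIGHT,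
`Π_{t≤m} f (t+1) (y t) / f t (y t)`, are written out in the statements (no definition). PROVED by
the source's induction over the extended state space (`Fin.snoc` decomposition of path sums):
**`sum_pathLaw_mul_aisWeight_mul`** (`Σ_paths law·weight·a(y m) = Σ_x f (m+1) x · a x` under the
support condition `f t x = 0 → f (t+1) x = 0` and invariance `Σ_x f t x · T t x z = f t z`),
**`sum_pathLaw`** (`Σ_paths law = Σ_x f 0 x` for stochastic `T`), hence **`aisWeight_mean_eq`**
(`E[w] = Z_target/Z_start` exactly — "the average of the importance weights converges to `Z_0/Z_n`")
and **`aisWeightedMean_eq`** (the weighted average of `a` has population value `E_target[a]`).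
Complementary to the `AIS` namespace above (Chapman–Kolmogorov recursion over a list of steps):
here the expectation is an explicit finite sum over all paths, with the row-stochasticity of `T`
used exactly once (`sum_pathLaw`). [cite: Neal2001AIS, §2] -/

section PathLaw

open Finset

variable {Ω : Type*} [Fintype Ω] {f : ℕ → Ω → ℝ} {T : ℕ → Ω → Ω → ℝ}

/-- Path sums over `m + 2` points split into the initial `m + 1` points and the last one
(`Fin.snocEquiv`). [folklore] -/
private theorem sum_path_snoc (m : ℕ) (F : (Fin (m + 2) → Ω) → ℝ) :
    ∑ y : Fin (m + 2) → Ω, F y = ∑ y' : Fin (m + 1) → Ω, ∑ z : Ω, F (Fin.snoc y' z) := by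
  have h := Fintype.sum_equiv (Fin.snocEquiv fun _ : Fin (m + 2) => Ω)
    (fun q : Ω × (Fin (m + 1) → Ω) => F (Fin.snoc q.2 q.1)) F (fun q => rfl)
  rw [← h, Fintype.sum_prod_type, Finset.sum_comm]

/-- Path sums over one point are sums over `Ω`. [folklore] -/
private theorem sum_path_one (F : (Fin 1 → Ω) → ℝ) :
    ∑ y : Fin 1 → Ω, F y = ∑ x : Ω, F (fun _ => x) := by
  refine Fintype.sum_equiv (Equiv.funUnique (Fin 1) Ω) F (fun x => F fun _ => x) (fun y => ?_)
  congr 1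
  funext i
  rw [Equiv.funUnique_apply]
  congr 1
  exact Subsingleton.elim _ _

/-- The cancellation `a · (b/a) = b` under the support condition `a = 0 → b = 0`. [folklore] -/
private theorem mul_div_cancel_of_supp {a b : ℝ} (h : a = 0 → b = 0) : a * (b / a) = b := by
  by_cases ha : a = 0
  · rw [ha, h ha, zero_mul]
  · exact mul_div_cancel₀ b ha

omit [Fintype Ω] in
/-- The law of a path with one more transition: `law (snoc y' z) = law y' · T (m+1) (y' m) z`.
[folklore] -/
private theorem pathLaw_snoc (m : ℕ) (y' : Fin (m + 1) → Ω) (z : Ω) :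
    f 0 ((Fin.snoc y' z : Fin (m + 2) → Ω) 0) *
        ∏ t : Fin (m + 1), T ((t : ℕ) + 1) ((Fin.snoc y' z : Fin (m + 2) → Ω) t.castSucc)
          ((Fin.snoc y' z : Fin (m + 2) → Ω) t.succ) =
      (f 0 (y' 0) * ∏ t : Fin m, T ((t : ℕ) + 1) (y' t.castSucc) (y' t.succ)) *
        T (m + 1) (y' (Fin.last m)) z := by
  rw [Fin.prod_univ_castSucc]
  have h0 : (Fin.snoc y' z : Fin (m + 2) → Ω) 0 = y' 0 := by
    rw [← Fin.castSucc_zero, Fin.snoc_castSucc]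
  have hlast : T (((Fin.last m) : ℕ) + 1)
      ((Fin.snoc y' z : Fin (m + 2) → Ω) (Fin.last m).castSucc)
      ((Fin.snoc y' z : Fin (m + 2) → Ω) (Fin.last m).succ) =
      T (m + 1) (y' (Fin.last m)) z := by
    rw [Fin.snoc_castSucc, Fin.succ_last, Fin.snoc_last, Fin.val_last]
  have hmid : ∀ t : Fin m, T (((t.castSucc : Fin (m + 1)) : ℕ) + 1)
      ((Fin.snoc y' z : Fin (m + 2) → Ω) t.castSucc.castSucc)
      ((Fin.snoc y' z : Fin (m + 2) → Ω) t.castSucc.succ) =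
      T ((t : ℕ) + 1) (y' t.castSucc) (y' t.succ) := by
    intro t
    rw [Fin.snoc_castSucc, Fin.succ_castSucc, Fin.snoc_castSucc, Fin.val_castSucc]
  rw [h0, hlast, Finset.prod_congr rfl fun t _ => hmid t]
  ring

omit [Fintype Ω] in
/-- The weight of a path with one more point:
`weight (snoc y' z) = weight y' · f (m+2) z / f (m+1) z`. [folklore] -/
private theorem aisWeight_snoc (m : ℕ) (y' : Fin (m + 1) → Ω) (z : Ω) :
    ∏ t : Fin (m + 2), f ((t : ℕ) + 1) ((Fin.snoc y' z : Fin (m + 2) → Ω) t) /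
        f (t : ℕ) ((Fin.snoc y' z : Fin (m + 2) → Ω) t) =
      (∏ t : Fin (m + 1), f ((t : ℕ) + 1) (y' t) / f (t : ℕ) (y' t)) *
        (f (m + 2) z / f (m + 1) z) := by
  rw [Fin.prod_univ_castSucc]
  have hlast : f (((Fin.last (m + 1)) : ℕ) + 1) ((Fin.snoc y' z : Fin (m + 2) → Ω) (Fin.last (m + 1))) /
      f ((Fin.last (m + 1)) : ℕ) ((Fin.snoc y' z : Fin (m + 2) → Ω) (Fin.last (m + 1))) =
      f (m + 2) z / f (m + 1) z := by
    rw [Fin.snoc_last, Fin.val_last]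
  have hmid : ∀ t : Fin (m + 1), f (((t.castSucc : Fin (m + 2)) : ℕ) + 1)
      ((Fin.snoc y' z : Fin (m + 2) → Ω) t.castSucc) /
      f ((t.castSucc : Fin (m + 2)) : ℕ) ((Fin.snoc y' z : Fin (m + 2) → Ω) t.castSucc) =
      f ((t : ℕ) + 1) (y' t) / f (t : ℕ) (y' t) := by
    intro t
    rw [Fin.snoc_castSucc, Fin.val_castSucc]
  rw [hlast, Finset.prod_congr rfl fun t _ => hmid t]

/-- **The transitions are stochastic ⇒ the path law has the mass of the start law**:
`Σ_paths f 0 (y 0) Π_{t<m} T (t+1) (y t) (y (t+1)) = Σ_x f 0 x` ("the normalizing constant for `g`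
… is the same as that for `f_n`"). [cite: Neal2001AIS, §2 (p0004–p0005: eq. (eq-extg) and "Z_n = ∫ f_n")] -/
theorem sum_pathLaw (m : ℕ) (hT : ∀ t, 1 ≤ t → t ≤ m → ∀ x, ∑ z, T t x z = 1) :
    ∑ y : Fin (m + 1) → Ω, f 0 (y 0) * ∏ t : Fin m, T ((t : ℕ) + 1) (y t.castSucc) (y t.succ) =
      ∑ x, f 0 x := by
  induction m with
  | zero =>
    rw [sum_path_one]
    exact Finset.sum_congr rfl fun x _ => by simp
  | succ m ih =>
    rw [sum_path_snoc]
    have hstep : ∀ y' : Fin (m + 1) → Ω,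
        ∑ z : Ω, f 0 ((Fin.snoc y' z : Fin (m + 2) → Ω) 0) *
          ∏ t : Fin (m + 1), T ((t : ℕ) + 1) ((Fin.snoc y' z : Fin (m + 2) → Ω) t.castSucc)
            ((Fin.snoc y' z : Fin (m + 2) → Ω) t.succ) =
        f 0 (y' 0) * ∏ t : Fin m, T ((t : ℕ) + 1) (y' t.castSucc) (y' t.succ) := by
      intro y'
      simp_rw [pathLaw_snoc]
      rw [← Finset.mul_sum, hT (m + 1) (by omega) le_rfl, mul_one]
    rw [Finset.sum_congr rfl fun y' _ => hstep y']
    exact ih fun t h1 h2 => hT t h1 (by omega)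

/-- **Neal's extended-state-space identity**: under the support condition (`f t x = 0 →
f (t+1) x = 0`, "`p_j ≠ 0` wherever `p_{j-1} ≠ 0`") and the invariance of each intermediate law
under its transition (`Σ_x f t x T t x z = f t z`, `1 ≤ t ≤ m`), for every observable `a` of the
final point, `Σ_paths law(y) · weight(y) · a(y m) = Σ_x f (m+1) x · a x` — the path law times the
AIS weight has the TARGET as the marginal of its final point (the source's `f(x_0,…,x_{n-1})` has
marginal `f_0`). [cite: Neal2001AIS, §2 (p0004:L49–L80, eqs. (eq-aisw), (eq-extf), (eq-extg))] -/
theorem sum_pathLaw_mul_aisWeight_mul (m : ℕ)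
    (hsupp : ∀ t, t ≤ m → ∀ x, f t x = 0 → f (t + 1) x = 0)
    (hinv : ∀ t, 1 ≤ t → t ≤ m → ∀ z, ∑ x, f t x * T t x z = f t z) (a : Ω → ℝ) :
    ∑ y : Fin (m + 1) → Ω, (f 0 (y 0) * ∏ t : Fin m, T ((t : ℕ) + 1) (y t.castSucc) (y t.succ)) *
      (∏ t : Fin (m + 1), f ((t : ℕ) + 1) (y t) / f (t : ℕ) (y t)) * a (y (Fin.last m)) =
      ∑ x, f (m + 1) x * a x := by
  induction m generalizing a with
  | zero =>
    rw [sum_path_one]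
    refine Finset.sum_congr rfl fun x _ => ?_
    have hs : f 0 x = 0 → f 1 x = 0 := hsupp 0 le_rfl x
    have hprod : ∏ t : Fin (0 + 1), f ((t : ℕ) + 1) ((fun _ : Fin (0 + 1) => x) t) /
        f (t : ℕ) ((fun _ : Fin (0 + 1) => x) t) = f 1 x / f 0 x := by
      rw [Fin.prod_univ_succ, Finset.univ_eq_empty, Finset.prod_empty, mul_one]
      exact rfl
    rw [hprod, Finset.univ_eq_empty, Finset.prod_empty, mul_one, mul_div_cancel_of_supp hs]
  | succ m ih =>
    rw [sum_path_snoc]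
    -- the inner sum over the new point, for a fixed initial path
    set h : Ω → ℝ := fun x => ∑ z, T (m + 1) x z * (f (m + 2) z / f (m + 1) z) * a z with hh
    have hstep : ∀ y' : Fin (m + 1) → Ω,
        ∑ z : Ω, (f 0 ((Fin.snoc y' z : Fin (m + 2) → Ω) 0) *
          ∏ t : Fin (m + 1), T ((t : ℕ) + 1) ((Fin.snoc y' z : Fin (m + 2) → Ω) t.castSucc)
            ((Fin.snoc y' z : Fin (m + 2) → Ω) t.succ)) *
          (∏ t : Fin (m + 2), f ((t : ℕ) + 1) ((Fin.snoc y' z : Fin (m + 2) → Ω) t) /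
            f (t : ℕ) ((Fin.snoc y' z : Fin (m + 2) → Ω) t)) *
          a ((Fin.snoc y' z : Fin (m + 2) → Ω) (Fin.last (m + 1))) =
        (f 0 (y' 0) * ∏ t : Fin m, T ((t : ℕ) + 1) (y' t.castSucc) (y' t.succ)) *
          (∏ t : Fin (m + 1), f ((t : ℕ) + 1) (y' t) / f (t : ℕ) (y' t)) * h (y' (Fin.last m)) := by
      intro y'
      simp_rw [pathLaw_snoc, aisWeight_snoc, Fin.snoc_last]
      rw [hh]
      simp only
      rw [Finset.mul_sum]
      exact Finset.sum_congr rfl fun z _ => by ring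
    rw [Finset.sum_congr rfl fun y' _ => hstep y']
    rw [ih (fun t ht x hx => hsupp t (by omega) x hx) (fun t h1 h2 z => hinv t h1 (by omega) z) h]
    -- Σ_x f (m+1) x h x = Σ_z (Σ_x f (m+1) x T (m+1) x z) (f (m+2) z / f (m+1) z) a z
    rw [hh]
    simp only
    calc ∑ x, f (m + 1) x * ∑ z, T (m + 1) x z * (f (m + 2) z / f (m + 1) z) * a z
        = ∑ z, (∑ x, f (m + 1) x * T (m + 1) x z) * ((f (m + 2) z / f (m + 1) z) * a z) := by
          simp_rw [Finset.mul_sum, Finset.sum_mul]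
          rw [Finset.sum_comm]
          exact Finset.sum_congr rfl fun z _ => Finset.sum_congr rfl fun x _ => by ring
      _ = ∑ z, f (m + 1) z * ((f (m + 2) z / f (m + 1) z) * a z) := by
          refine Finset.sum_congr rfl fun z _ => ?_
          rw [hinv (m + 1) (by omega) le_rfl z]
      _ = ∑ z, f (m + 2) z * a z := by
          refine Finset.sum_congr rfl fun z _ => ?_
          have hs : f (m + 1) z = 0 → f (m + 2) z = 0 := hsupp (m + 1) le_rfl z
          rw [← mul_assoc, mul_div_cancel_of_supp hs]

/-- **"The average of the importance weights … converges to the ratio of these normalizing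
constants"**: the population mean of the AIS weight under the path law is EXACTLY
`Z_target/Z_start = (Σ_x f (m+1) x)/(Σ_x f 0 x)` — unbiasedness of one annealing run for the
ratio of normalising constants, whatever the mixing of the transitions.
[cite: Neal2001AIS, §2 (p0005:L15–L24)] -/
theorem aisWeight_mean_eq (m : ℕ) (hsupp : ∀ t, t ≤ m → ∀ x, f t x = 0 → f (t + 1) x = 0)
    (hinv : ∀ t, 1 ≤ t → t ≤ m → ∀ z, ∑ x, f t x * T t x z = f t z)
    (hT : ∀ t, 1 ≤ t → t ≤ m → ∀ x, ∑ z, T t x z = 1) :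
    (∑ y : Fin (m + 1) → Ω, (f 0 (y 0) * ∏ t : Fin m, T ((t : ℕ) + 1) (y t.castSucc) (y t.succ)) *
        ∏ t : Fin (m + 1), f ((t : ℕ) + 1) (y t) / f (t : ℕ) (y t)) /
      (∑ y : Fin (m + 1) → Ω, f 0 (y 0) * ∏ t : Fin m, T ((t : ℕ) + 1) (y t.castSucc) (y t.succ)) =
      (∑ x, f (m + 1) x) / ∑ x, f 0 x := by
  have h := sum_pathLaw_mul_aisWeight_mul m hsupp hinv (fun _ => (1 : ℝ))
  simp only [mul_one] at h
  rw [h, sum_pathLaw m hT]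

/-- **The AIS estimator of a target expectation** (the source's weighted average (eq-is) with the
weights (eq-aisw), population version): `(Σ_paths law·weight·a(y m))/(Σ_paths law·weight) =
(Σ_x f (m+1) x a x)/(Σ_x f (m+1) x) = E_{target}[a]`. [cite: Neal2001AIS, §2 (p0004:L47–L52)] -/
theorem aisWeightedMean_eq (m : ℕ) (hsupp : ∀ t, t ≤ m → ∀ x, f t x = 0 → f (t + 1) x = 0)
    (hinv : ∀ t, 1 ≤ t → t ≤ m → ∀ z, ∑ x, f t x * T t x z = f t z) (a : Ω → ℝ) :
    (∑ y : Fin (m + 1) → Ω, (f 0 (y 0) * ∏ t : Fin m, T ((t : ℕ) + 1) (y t.castSucc) (y t.succ)) *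
        (∏ t : Fin (m + 1), f ((t : ℕ) + 1) (y t) / f (t : ℕ) (y t)) * a (y (Fin.last m))) /
      (∑ y : Fin (m + 1) → Ω, (f 0 (y 0) * ∏ t : Fin m, T ((t : ℕ) + 1) (y t.castSucc) (y t.succ)) *
        ∏ t : Fin (m + 1), f ((t : ℕ) + 1) (y t) / f (t : ℕ) (y t)) =
      (∑ x, f (m + 1) x * a x) / ∑ x, f (m + 1) x := by
  have h1 := sum_pathLaw_mul_aisWeight_mul m hsupp hinv a
  have h2 := sum_pathLaw_mul_aisWeight_mul m hsupp hinv (fun _ => (1 : ℝ))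
  simp only [mul_one] at h2
  rw [h1, h2]

end PathLaw

end Literature.Probability.ImportanceSampling

end
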